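import Summits.ValiantsHypothesis.ValiantsHypothesis.Theses.NewtonUnitEquations
import Summits.ValiantsHypothesis.ValiantsHypothesis.Theorems.NewtonUnitEquationsTwoProductsMahlerRadixRecursionStubOuterVertices
import Summits.ValiantsHypothesis.ValiantsHypothesis.Theorems.TwoProducts.Negative.RankObstruction

/-!
# Line `mahler-radix-recursion` — checked skeleton for crux `TwoProducts` (stmt-ValiantsHypothesis-5906)

Crux (`Summit.ValiantsHypothesis.ValiantsHypothesis.Theses.NewtonUnitEquations.TwoProducts`, shared with route
NewtonFrames): `∃ a b, ∀ m t (f g : Fin m → ℂ[X,Y])` `t`-sparse, `#vert Newt(∏ f − ∏ g) ≤ 2^(a·m)·(t+2)^b`.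

## The line (idea card `Ideas/mahler-radix-recursion.md`, triage TRIAGE-r1-{1,2,3}: pass, "make the per-scale
increment the explicit first stub")

INDUCT ON SCALES.  Peeling one factor pair `(f_i, g_i)` splits the difference of the two products as
`∏ f − ∏ g = f_i · W_i + (f_i − g_i) · S_i`, `W_i = ∏_{j≠i} f_j − ∏_{j≠i} g_j` (the SAME crux one scale up),
`S_i = ∏_{j≠i} g_j` (`peel_identity`; the card's `RadixSplitting` is the case `f_j = D_j(X^{b^j},Y^{b^j})`, `i = 0`).
The Newton polygon of the difference sits inside the FRAME HULL `K_i = conv(supp(f_i W_i) ∪ supp((f_i − g_i) S_i))`,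
whose vertices are controlled by Ostrowski (`Newt(pq) = Newt p + Newt q`) and the planar Minkowski count:
`#vert K_i ≤ vert(W_i) + (m+3)t` — stub (α) `OuterVertices`, provable now.  Every other vertex is HIDDEN
(manufactured by cancellation between the two summands on `∂K_i`; each coefficient there is a short sum
`Σ_{d ∈ supp f_i} f_i[d]·W_i[e−d] + …` of `≤ 3t` terms — the card's "short carry fibres" in general form).  The
load-bearing claim of the line is the SCALE STEP in the weak multiplicative form that matches the crux's shape
`2^{O(m)}·poly(t)` read inductively: stub (β) `HiddenVertices` — some pair can be peeled with
`#hidden ≤ 2^a·vert(W_i) + (m+t+2)^c`.  (α)+(β) give `V(m+1) ≤ (2^a+1)·V(m) + (m+3)t + (m+t+2)^c`, whence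
`V(m) ≤ 2^{(a+c+4)m}(t+2)^{2c+4}`: `TwoProducts_of` (kernel-checked below, sorries only in the stubs).

THE RADIX REGIME (the card's engine, C⁺_radix): for `f_j = expand (b^j) D_j` with `t`-sparse digit polynomials of
exponents `< r·b` (base `b ≥ 2`, carry range `r`; `r = 1` = KPTT Ex. 3 digit grids, `r ≥ 2` = carries) the coarse
pair is self-similar — `W_0 = expand_b(W′)` with `W′` the `m`-scale instance of the shifted digits (Mahler's functional
equation, `coarseDiff_radix_zero`, and `vert ∘ expand_b = vert`, `vert_expand`, both PROVED here) — and the card claims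
the step is ADDITIVE in `vert(W′)` uniformly in `m` and `b`: stub (β_r) `RadixScaleStep`,
`vert(∏ f − ∏ g) ≤ vert(W′) + (m+3)·t + (t+r+2)^κ` when the finest scale is peeled (the `(m+3)·t` is the Ostrowski
allowance of (α); it is NECESSARY: if the coarse digits agree, `P′ = Q′`, then `vert(W′) = 0` while
`Newt(∏ f − ∏ g) = Newt(D₀ − E₀) + b·Newt(P′)` has up to `2t + m·t` vertices).  (β_r) gives the regime theorem
`RadixTwoProducts` (`vert ≤ (m+t+r+2)^{κ+4}`, polynomial, uniform in the base): `radixTwoProducts_of` (kernel-checked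
below).  (β_r) is the statement the three triagers asked to be exposed to refuters ("V(m) ≤ V(m−1) + poly(t, ⌈c/b⌉)",
with `2 ≤ b` written in, corrected by the Ostrowski allowance); it does not feed `TwoProducts_of` — there is no
reduction general → radix (card, honest limit (a); triage) — it is the line's first milestone and the evidence base for
(β).  Why (β_r) is stated on TOTAL counts and (β) on hidden ones: the frame accounting `vert ≤ #vert K + #hidden`
double-counts `vert(W)` when the whole boundary of `K` cancels (then every vertex is hidden and `#hidden ≈ vert(W′) + O(1)`,
planner probe kit/peel_climb.py: hidden₀ = 8, 12, 13, 15 at 2–5 scales, `b = 2, t = 3, r = 2`) — a factor 2 per scale,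
free inside the weak form (β), fatal for an additive regime claim.

PROBES (planner, local, exact arithmetic; scripts kit/peel_probe.py, kit/step_climb.py, outputs kit/*.out, attached):
hill-climbing the finest-peel increment `V(N) − vert(W′)` on radix data (`b ∈ {2,4}`, `t ∈ {2,3}`, `r ∈ {2,3}`, up to 8
scales, coefficients `±1, ±2`) gives 9–14, flat in the number of scales, the maxima all at degenerate coarse pairs
`vert(W′) = 0` (the Ostrowski mechanism above, `≤ (m+3)t`); with `vert(W′) > 0` the increment found is `≤ 8`.  On general
`t = 3` instances (exponent box 8–10, up to 6 factor pairs) `min_i (V(N) − vert(W_i)) ≤ 6`, flat.  Nothing found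
against (β) with `a = 1` or (β_r); sizes are small (search-limited), recorded as smoke only.

## Disproof.lean honoured (cdisprove cycle 1, `Cruxes/TwoProducts/Disproof.lean`)
`twoProducts_false_without_sparsityF/G`: sparsity of BOTH products is used — of `f_i`, `f_i − g_i` and every `g_j`
in (α), of everything in (β)/(β_r).  `not_twoProductsBoundFreeOfM` (`∏(1+XY^j)`, `t = 2`, `≥ m+1` vertices): the
spine's bound is `2^{(a+c+4)m}·poly(t)` and the regime bound `(m+t+r+2)^{κ+4}` — `m` enters both (that family is
radix only with `r ≥ m`).  `not_twoProductsBoundFreeOfT`: `t` enters both.  §3 F3 (`t = 2 ⇒ ≤ 8m²+O(m)`) and F9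
(`FirstOrderCount`, open) are consistent with (β) (`a = 0` there).  `-- Targets`: none.  The one landed Negative
file, `Theorems/TwoProducts/Negative/RankObstruction.lean` (imported here as the check), concerns zero patterns of
rank-`≤ 2m` matrices on a common tail cone (the log line's count); no stub below is an instance it refutes.

## Stubs (registered by `ledger skeleton check`): `stub_outerVertices` (α, provable now, M/L),
`stub_hiddenVertices` (β, OPEN — hardest, crux-complete), `stub_radixScaleStep` (β_r, OPEN — the regime engine).
Everything else in this file is proved (`TwoProducts_of` uses α, β; `radixTwoProducts_of` uses β_r).
-/

set_option linter.dupNamespace false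

namespace Summit.ValiantsHypothesis.ValiantsHypothesis.Cruxes.TwoProducts.MahlerRadixRecursion

open scoped BigOperators
open MvPolynomial

noncomputable section

/-! ## Vertex counts -/

/-- Bivariate complex polynomials. [folklore] -/
abbrev Poly := MvPolynomial (Fin 2) ℂ

/-- The planar point of an exponent vector, exactly as inlined in the crux. [folklore] -/
abbrev ι : (Fin 2 →₀ ℕ) → (Fin 2 → ℝ) := fun e i => ((e i : ℕ) : ℝ)

/-- Vertex set of the lattice polygon `conv(A)` of a finite exponent set `A`. [folklore] -/
abbrev Vx (A : Finset (Fin 2 →₀ ℕ)) : Set (Fin 2 → ℝ) :=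
  Set.extremePoints ℝ (convexHull ℝ (ι '' (A : Set (Fin 2 →₀ ℕ))))

/-- Number of vertices of the Newton polygon of `W` (definitionally the crux's count and the Literature
abbreviation `newtonVertexCount`). [folklore] -/
abbrev vert (W : Poly) : ℕ := (Vx W.support).ncard

/-- Sanity: the crux is literally the `vert`-bound for the difference of two products. [folklore] -/
theorem twoProducts_iff :
    Theses.NewtonUnitEquations.TwoProducts ↔
      ∃ a b : ℕ, ∀ (m t : ℕ) (f g : Fin m → Poly), (∀ j, (f j).support.card ≤ t) →
        (∀ j, (g j).support.card ≤ t) → vert (∏ j, f j - ∏ j, g j) ≤ 2 ^ (a * m) * (t + 2) ^ b :=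
  Iff.rfl

/-- The vertex set of a lattice polygon is finite. [folklore] -/
theorem Vx_finite (A : Finset (Fin 2 →₀ ℕ)) : (Vx A).Finite :=
  (Set.Finite.image ι (Finset.finite_toSet A)).subset extremePoints_convexHull_subset

/-- A lattice polygon has at most as many vertices as generating points. [folklore] -/
theorem ncard_Vx_le (A : Finset (Fin 2 →₀ ℕ)) : (Vx A).ncard ≤ A.card :=
  calc (Vx A).ncard ≤ (ι '' (A : Set (Fin 2 →₀ ℕ))).ncard :=
        Set.ncard_le_ncard extremePoints_convexHull_subset (Set.Finite.image ι (Finset.finite_toSet A))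
    _ ≤ (A : Set (Fin 2 →₀ ℕ)).ncard := Set.ncard_image_le (Finset.finite_toSet A)
    _ = A.card := Set.ncard_coe_finset A

/-- `Newt(0)` has no vertices. [folklore] -/
theorem vert_zero : vert (0 : Poly) = 0 := by
  have h := ncard_Vx_le (0 : Poly).support
  rw [support_zero, Finset.card_empty] at h
  exact Nat.le_zero.1 h

/-! ## Peeling one factor pair (one scale) -/

/-- The COARSE DIFFERENCE after peeling the pair `(f_i, g_i)`: `W_i = ∏_{j ≠ i} f_j − ∏_{j ≠ i} g_j` — an
instance of the crux with one factor pair fewer. [folklore] -/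
def coarseDiff {m : ℕ} (f g : Fin (m + 1) → Poly) (i : Fin (m + 1)) : Poly :=
  ∏ j, f (i.succAbove j) - ∏ j, g (i.succAbove j)

/-- The COARSE PRODUCT `S_i = ∏_{j ≠ i} g_j`. [folklore] -/
def coarseProd {m : ℕ} (g : Fin (m + 1) → Poly) (i : Fin (m + 1)) : Poly :=
  ∏ j, g (i.succAbove j)

/-- The PEEL FRAME: the union of the supports of the two summands of the splitting
`∏ f − ∏ g = f_i · W_i + (f_i − g_i) · S_i`; its hull `K_i` contains `Newt(∏ f − ∏ g)`. [folklore] -/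
def peelFrame {m : ℕ} (f g : Fin (m + 1) → Poly) (i : Fin (m + 1)) : Finset (Fin 2 →₀ ℕ) :=
  (f i * coarseDiff f g i).support ∪ ((f i - g i) * coarseProd g i).support

/-- HIDDEN (manufactured) vertices of the peel at `i`: vertices of `Newt(∏ f − ∏ g)` that are not vertices
of the frame hull `K_i`; they exist only through cancellation between the two summands on `∂K_i`. [folklore] -/
def hidden {m : ℕ} (f g : Fin (m + 1) → Poly) (i : Fin (m + 1)) : ℕ :=
  (Vx (∏ j, f j - ∏ j, g j).support \ Vx (peelFrame f g i)).ncard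

/-- The splitting identity behind the recursion (general form of the card's `RadixSplitting`):
`∏ f − ∏ g = f_i · W_i + (f_i − g_i) · S_i`. [folklore] -/
theorem peel_identity {m : ℕ} (f g : Fin (m + 1) → Poly) (i : Fin (m + 1)) :
    ∏ j, f j - ∏ j, g j = f i * coarseDiff f g i + (f i - g i) * coarseProd g i := by
  rw [Fin.prod_univ_succAbove f i, Fin.prod_univ_succAbove g i, coarseDiff, coarseProd]
  ring

/-- The support of the difference lies in the peel frame (so `Newt(∏ f − ∏ g) ⊆ K_i`). [folklore] -/
theorem support_subset_peelFrame {m : ℕ} (f g : Fin (m + 1) → Poly) (i : Fin (m + 1)) :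
    (∏ j, f j - ∏ j, g j).support ⊆ peelFrame f g i := by
  rw [peel_identity f g i, peelFrame]
  exact support_add

/-- ONE SCALE STEP, accounting form: `vert(∏ f − ∏ g) ≤ #vert(K_i) + #hidden_i` (vertices of the difference
that are vertices of `K_i` are counted by the first term, the others by definition by the second). [folklore] -/
theorem vert_le_outer_add_hidden {m : ℕ} (f g : Fin (m + 1) → Poly) (i : Fin (m + 1)) :
    vert (∏ j, f j - ∏ j, g j) ≤ (Vx (peelFrame f g i)).ncard + hidden f g i := by
  have hsplit := Set.ncard_inter_add_ncard_sdiff_eq_ncard (Vx (∏ j, f j - ∏ j, g j).support)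
    (Vx (peelFrame f g i)) (Vx_finite _)
  have hle : (Vx (∏ j, f j - ∏ j, g j).support ∩ Vx (peelFrame f g i)).ncard ≤
      (Vx (peelFrame f g i)).ncard :=
    Set.ncard_le_ncard Set.inter_subset_right (Vx_finite _)
  change (Vx (∏ j, f j - ∏ j, g j).support).ncard ≤
    (Vx (peelFrame f g i)).ncard + (Vx (∏ j, f j - ∏ j, g j).support \ Vx (peelFrame f g i)).ncard
  omega

/-! ## The two stubs of the spine -/

/-- STUB (α) `OuterVertices` — "everything else is Ostrowski" (triage): the frame hull `K_i` has at most
`vert(W_i) + (m+3)·t` vertices: `≤ t` from `Newt f_i` plus `vert W_i` (Ostrowski `Newt(f_i W_i) = Newt f_i + Newt W_i`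
and the planar Minkowski count `#vert(A + B) ≤ #vert A + #vert B`), `≤ 2t` from `Newt(f_i − g_i)` plus `≤ m·t` from
`Newt S_i = Σ_{j≠i} Newt g_j`, and `#vert conv(X ∪ Y) ≤ #vert conv X + #vert conv Y`.  A theorem on paper
(Ostrowski's `NP(f₁f₂) = NP(f₁) + NP(f₂)` over `ℂ`: Cox–Little–O'Shea, *Using Algebraic Geometry* (2005) Ch. 7 §4
Ex. 3(a); faces of Minkowski sums are sums of faces, ibid. Prop. (4.3), whence a planar Minkowski sum of polygons with
`V₁`, `V₂` vertices has `≤ V₁ + V₂`), provable now; size M–L in Lean (neither fact is in Mathlib).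
Why it might fail: it cannot (degenerate cases `W_i = 0`, `f_i = g_i`, `m = 0` checked: both sides collapse). -/
def OuterVertices : Prop :=
  ∀ (m t : ℕ) (f g : Fin (m + 1) → Poly) (i : Fin (m + 1)), (∀ j, (f j).support.card ≤ t) →
    (∀ j, (g j).support.card ≤ t) → (Vx (peelFrame f g i)).ncard ≤ vert (coarseDiff f g i) + (m + 3) * t

/-- STUB (β) `HiddenVertices` — the load-bearing SCALE STEP in weak (multiplicative) form: for `t`-sparse
`f, g : Fin (m+1) → ℂ[X,Y]` SOME factor pair `i` can be peeled so that the hidden vertices number at most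
`2^a · vert(W_i) + (m+t+2)^c`, with absolute `a, c`.  It is a genuine strengthening of the crux (relative control by
the coarse instance, which the crux does not give), chosen in the shape `2^{O(m)}·poly(t)` read inductively: one more
scale may cost a CONSTANT FACTOR plus `poly(m,t)` new vertices.  Why easier: it is one peel — a single sparse pair
against a fixed structured pair `(W_i, S_i)`; hidden vertices need cancellation on `∂K_i`, where every coefficient is
a sum of `≤ 3t` products (short fibres); in the radix regime the step is self-similar (β_r below).
Why it might fail: a coarse difference `W_i` with `O(1)` hull vertices but a deep structured interior (box/numeration
differences `N_b⊗N_b − N_c⊗N_c`, cyclotomic designs) from which one cleverly chosen pair `(f_i, g_i)` exposes a long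
convex chain — `#hidden ≫ vert(W_i) + poly` for EVERY `i` — would kill it while leaving the crux open.  OPEN. -/
def HiddenVertices : Prop :=
  ∃ a c : ℕ, ∀ (m t : ℕ) (f g : Fin (m + 1) → Poly), (∀ j, (f j).support.card ≤ t) →
    (∀ j, (g j).support.card ≤ t) →
      ∃ i : Fin (m + 1), hidden f g i ≤ 2 ^ a * vert (coarseDiff f g i) + (m + t + 2) ^ c

/-- Stub (α): the outer (Ostrowski) vertex budget of one peel.  Registered stub of line `mahler-radix-recursion`;
provable now. -/
theorem stub_outerVertices : OuterVertices := by
  -- LANDED (`…MahlerRadixRecursionStubOuterVertices`, `…MahlerRadixRecursion.stub_outerVertices`, statement unfolded verbatim): by-name citation (stub-credit wiring val-port-1 g1, val-lit RULING #251 (b))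
  exact Summit.ValiantsHypothesis.ValiantsHypothesis.Theorems.NewtonUnitEquations.TwoProducts.MahlerRadixRecursion.stub_outerVertices
/-- Stub (β): the weak multiplicative scale step.  Registered stub of line `mahler-radix-recursion`; OPEN, the
hardest stub (with (α) it implies the crux, `TwoProducts_of`). -/
theorem stub_hiddenVertices : HiddenVertices := by
  sorry

/-! ## From the scale step to the crux: `V(m+1) ≤ (2^a+1)·V(m) + (m+3)t + (m+t+2)^c` -/

/-- The added term of one step: `g(k) = (k+3)t + (k+t+2)^c`. [folklore] -/
def gterm (t c k : ℕ) : ℕ := (k + 3) * t + (k + t + 2) ^ c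

/-- The recursion bound `F(0) = 0`, `F(k+1) = A·F(k) + g(k)`. [folklore] -/
def F (A t c : ℕ) : ℕ → ℕ
  | 0 => 0
  | k + 1 => A * F A t c k + gterm t c k

/-- INDUCTION ON SCALES: (α) and (β) (with constants `a, c`) bound `vert(∏ f − ∏ g)` by `F(2^a+1, t, c, m)`.
[folklore] -/
theorem vert_le_F (hα : OuterVertices) {a c : ℕ}
    (hβ : ∀ (m t : ℕ) (f g : Fin (m + 1) → Poly), (∀ j, (f j).support.card ≤ t) →
      (∀ j, (g j).support.card ≤ t) →
        ∃ i : Fin (m + 1), hidden f g i ≤ 2 ^ a * vert (coarseDiff f g i) + (m + t + 2) ^ c) :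
    ∀ (m t : ℕ) (f g : Fin m → Poly), (∀ j, (f j).support.card ≤ t) → (∀ j, (g j).support.card ≤ t) →
      vert (∏ j, f j - ∏ j, g j) ≤ F (2 ^ a + 1) t c m := by
  intro m
  induction m with
  | zero =>
    intro t f g _ _
    have h0 : (∏ j, f j - ∏ j, g j : Poly) = 0 := by simp
    rw [h0, vert_zero]
    exact Nat.zero_le _
  | succ m ih =>
    intro t f g hf hg
    obtain ⟨i, hi⟩ := hβ m t f g hf hg
    have hK := hα m t f g i hf hg
    have hW : vert (coarseDiff f g i) ≤ F (2 ^ a + 1) t c m :=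
      ih t (fun j => f (i.succAbove j)) (fun j => g (i.succAbove j)) (fun j => hf _) (fun j => hg _)
    calc vert (∏ j, f j - ∏ j, g j)
        ≤ (Vx (peelFrame f g i)).ncard + hidden f g i := vert_le_outer_add_hidden f g i
      _ ≤ (vert (coarseDiff f g i) + (m + 3) * t) + (2 ^ a * vert (coarseDiff f g i) + (m + t + 2) ^ c) :=
          add_le_add hK hi
      _ = (2 ^ a + 1) * vert (coarseDiff f g i) + gterm t c m := by unfold gterm; ring
      _ ≤ (2 ^ a + 1) * F (2 ^ a + 1) t c m + gterm t c m := by gcongr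
      _ = F (2 ^ a + 1) t c (m + 1) := rfl

/-- `g` is monotone in the scale index. [folklore] -/
theorem gterm_mono (t c k : ℕ) : gterm t c k ≤ gterm t c (k + 1) := by
  unfold gterm
  gcongr <;> omega

/-- Unrolling the recursion: `F(k) ≤ k·A^k·g(k)` for `A ≥ 1`. [folklore] -/
theorem F_le (A t c : ℕ) (hA : 1 ≤ A) : ∀ k, F A t c k ≤ k * A ^ k * gterm t c k
  | 0 => by simp [F]
  | k + 1 => by
    have ih := F_le A t c hA k
    have hg := gterm_mono t c k
    have hAk : 1 ≤ A ^ (k + 1) := Nat.one_le_pow _ _ hA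
    calc F A t c (k + 1) = A * F A t c k + gterm t c k := rfl
      _ ≤ A * (k * A ^ k * gterm t c k) + gterm t c k := by gcongr
      _ ≤ A * (k * A ^ k * gterm t c (k + 1)) + A ^ (k + 1) * gterm t c (k + 1) := by
          gcongr A * (k * A ^ k * ?_) + ?_
          calc gterm t c k ≤ gterm t c (k + 1) := hg
            _ = 1 * gterm t c (k + 1) := (one_mul _).symm
            _ ≤ A ^ (k + 1) * gterm t c (k + 1) := Nat.mul_le_mul_right _ hAk
      _ = (k + 1) * A ^ (k + 1) * gterm t c (k + 1) := by ring

/-- The step term is polynomial: `g(m) ≤ (m+t+3)^(c+2)`. [folklore] -/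
theorem gterm_le (t c m : ℕ) : gterm t c m ≤ (m + t + 3) ^ (c + 2) := by
  unfold gterm
  have h1 : 1 ≤ (m + t + 2) ^ c := Nat.one_le_pow _ _ (by omega)
  have h2 : (m + t + 2) ^ c ≤ (m + t + 3) ^ c := Nat.pow_le_pow_left (by omega) c
  have h3 : (m + 3) * t + 1 ≤ (m + t + 3) ^ 2 := by nlinarith
  calc (m + 3) * t + (m + t + 2) ^ c
      ≤ (m + t + 2) ^ c * ((m + 3) * t) + (m + t + 2) ^ c := by
        nlinarith [Nat.mul_le_mul_right ((m + 3) * t) h1]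
    _ = (m + t + 2) ^ c * ((m + 3) * t + 1) := by ring
    _ ≤ (m + t + 3) ^ c * (m + t + 3) ^ 2 := Nat.mul_le_mul h2 h3
    _ = (m + t + 3) ^ (c + 2) := by ring

/-- Closed form: `F(2^a+1, t, c, m) ≤ 2^((a+c+4)m)·(t+2)^(2c+4)`. [folklore] -/
theorem F_bound (a c t m : ℕ) : F (2 ^ a + 1) t c m ≤ 2 ^ ((a + c + 4) * m) * (t + 2) ^ (2 * c + 4) := by
  have hA : 1 ≤ 2 ^ a + 1 := Nat.le_add_left 1 _
  have h1 : m ≤ 2 ^ m := Nat.lt_two_pow_self.le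
  have h2 : (2 ^ a + 1) ^ m ≤ (2 ^ (a + 1)) ^ m := by
    apply Nat.pow_le_pow_left
    have := Nat.one_le_two_pow (n := a)
    rw [pow_succ]; omega
  have h3 : gterm t c m ≤ (2 ^ m) ^ (c + 2) * (t + 2) ^ (2 * (c + 2)) := by
    have hm : m + 1 ≤ 2 ^ m := Nat.lt_two_pow_self
    have ht : t + 3 ≤ (t + 2) ^ 2 := by nlinarith
    have hb : m + t + 3 ≤ 2 ^ m * (t + 2) ^ 2 :=
      calc m + t + 3 ≤ (m + 1) * (t + 3) := by nlinarith
        _ ≤ 2 ^ m * (t + 2) ^ 2 := Nat.mul_le_mul hm ht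
    calc gterm t c m ≤ (m + t + 3) ^ (c + 2) := gterm_le t c m
      _ ≤ (2 ^ m * (t + 2) ^ 2) ^ (c + 2) := Nat.pow_le_pow_left hb _
      _ = (2 ^ m) ^ (c + 2) * (t + 2) ^ (2 * (c + 2)) := by rw [mul_pow, ← pow_mul (t + 2) 2 (c + 2)]
  calc F (2 ^ a + 1) t c m ≤ m * (2 ^ a + 1) ^ m * gterm t c m := F_le _ _ _ hA m
    _ ≤ 2 ^ m * (2 ^ (a + 1)) ^ m * ((2 ^ m) ^ (c + 2) * (t + 2) ^ (2 * (c + 2))) := by gcongr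
    _ = 2 ^ ((a + c + 4) * m) * (t + 2) ^ (2 * c + 4) := by ring

/-- **The skeleton theorem**: the stubs (α) `stub_outerVertices` and (β) `stub_hiddenVertices` imply the crux
`TwoProducts` BY NAME, with `a' = a + c + 4`, `b' = 2c + 4`.  Sorry-free apart from the two stubs it invokes.
[folklore] -/
theorem TwoProducts_of : Theses.NewtonUnitEquations.TwoProducts := by
  obtain ⟨a, c, hβ⟩ := stub_hiddenVertices
  refine ⟨a + c + 4, 2 * c + 4, fun m t f g hf hg => ?_⟩
  exact (vert_le_F stub_outerVertices hβ m t f g hf hg).trans (F_bound a c t m)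

/-! ## The radix regime (the card's engine `C⁺_radix`) -/

/-- Radix factors: `f_j = D_j(X^{b^j}, Y^{b^j}) = expand (b^j) D_j`. [folklore] -/
def radix (b : ℕ) {n : ℕ} (D : Fin n → Poly) : Fin n → Poly := fun j => expand (b ^ (j : ℕ)) (D j)

/-- STUB (β_r) `RadixScaleStep` — the card's per-scale increment "V(m) ≤ V(m−1) + poly(t, ⌈c/b⌉)", sharpened by
triage ("state it with `2 ≤ b`", "make the one-step increment the first lemma") and corrected by the Ostrowski
allowance: in base `b ≥ 2`, with `t`-sparse digit polynomials `D_j, E_j` whose exponents are `< r·b` (carry range `r`;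
`r = 1`: no carries, the dissociated KPTT Ex. 3 digit grids; `r ≥ 2`: representations carry), peeling the FINEST scale,
`vert(∏_j expand(b^j) D_j − ∏_j expand(b^j) E_j) ≤ vert(W_0) + (m+3)·t + (t+r+2)^κ`, uniformly in the number of scales
and in the base (`W_0 = coarseDiff … 0 = expand_b` of the shifted instance, `vert_coarseDiff_radix`).  ADDITIVE in
`vert(W_0)` (coefficient 1) — this is the regime engine; with it `RadixTwoProducts` follows (`radixTwoProducts_of`).
The allowance `(m+3)·t` cannot be dropped (coarse digits equal ⇒ `vert(W_0) = 0` but `Newt = Newt(D₀−E₀) + b·Newt(P′)`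
has up to `(m+2)t` vertices).  Proposed mechanism (line card): near each vertex `b·w` of `b·Newt(W′)` the fine structure is
a lattice "digit cloud" of diameter `O(rb)`; a cloud contributes manufactured vertices only for directions inside the
normal cone of `w`; a lattice polygon of height `≤ rb` meets an arc of width `θ` in `≤ 1 + O(θ·(rb)²)` normal cones and
`Σ_w θ_w = 2π` — the additivity that should make the increment independent of `vert(W′)`; uniformity in `b` needs the
`t`-sparsity of the clouds instead of their lattice height.
Why it might fail: (i) carries (`r ≥ 2`) let clouds of ADJACENT coarse boundary points (a perimeter's worth, not
`vert W′`) interact; (ii) if cancellation decorates every coarse vertex with its own germ-dependent cloud the honest count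
is `C·vert(W′) + poly` with `C > 1` (the multiplicative shape of (β)), and a designed family could double `V` per scale
inside the radix regime — that refutes (β_r) but not the crux; (iii) uniformity in `b` is untested beyond `b ≤ 4`.
Planner probes (kit/step_climb.py, exact, `b ∈ {2,4}`, `t ∈ {2,3}`, `r ∈ {2,3}`, ≤ 8 scales): max increment
`V − vert(W_0)` found 9–14, flat in the number of scales, maxima at `vert(W_0) = 0`; triage r1-3 probe: `V ≈ 2m`.  OPEN. -/
def RadixScaleStep : Prop :=
  ∃ κ : ℕ, ∀ (b r m t : ℕ) (D E : Fin (m + 1) → Poly), 2 ≤ b → (∀ j, (D j).support.card ≤ t) →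
    (∀ j, (E j).support.card ≤ t) → (∀ j, ∀ e ∈ (D j).support, ∀ l, e l < r * b) →
    (∀ j, ∀ e ∈ (E j).support, ∀ l, e l < r * b) →
      vert (∏ j, radix b D j - ∏ j, radix b E j) ≤
        vert (coarseDiff (radix b D) (radix b E) 0) + (m + 3) * t + (t + r + 2) ^ κ

/-- The regime target `RadixTwoProducts` (`C⁺_radix` of the card in polynomial form, uniform in the base): for radix
frames in base `b ≥ 2` with `t`-sparse digits of exponents `< r·b` on `m` scales,
`vert(∏_j D_j(X^{b^j},Y^{b^j}) − ∏_j E_j(X^{b^j},Y^{b^j})) ≤ (m + t + r + 2)^κ`.  It is the crux RESTRICTED to radix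
frames with a POLYNOMIAL bound (the crux allows `2^{am}`); not claimed equivalent to the crux.  Proved below from
(β_r) and Mahler's functional equation. -/
def RadixTwoProducts : Prop :=
  ∃ κ : ℕ, ∀ (b r m t : ℕ) (D E : Fin m → Poly), 2 ≤ b → (∀ j, (D j).support.card ≤ t) →
    (∀ j, (E j).support.card ≤ t) → (∀ j, ∀ e ∈ (D j).support, ∀ l, e l < r * b) →
    (∀ j, ∀ e ∈ (E j).support, ∀ l, e l < r * b) →
      vert (∏ j, radix b D j - ∏ j, radix b E j) ≤ (m + t + r + 2) ^ κ

/-- Stub (β_r): the additive per-scale increment of the radix regime.  Registered stub of line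
`mahler-radix-recursion`; OPEN (the regime engine; refuters attack here first). -/
theorem stub_radixScaleStep : RadixScaleStep := by
  sorry

/-! ### Mahler's functional equation: the coarse pair of a radix frame is the scaled shifted instance -/

/-- `vert` is invariant under `expand b` (`b ≠ 0`): the support is scaled by `b`, and a homothety of `ℝ²` maps
hull to hull and vertices to vertices. [folklore] -/
theorem vert_expand {b : ℕ} (hb : b ≠ 0) (W : Poly) : vert (expand b W) = vert W := by
  have hbR : (b : ℝ) ≠ 0 := by exact_mod_cast hb
  let L : (Fin 2 → ℝ) ≃ₗ[ℝ] (Fin 2 → ℝ) := LinearEquiv.smulOfNeZero ℝ (Fin 2 → ℝ) (b : ℝ) hbR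
  have hL : ∀ x : Fin 2 → ℝ, L x = (b : ℝ) • x := fun x => rfl
  have hι : ∀ e : Fin 2 →₀ ℕ, ι (b • e) = L (ι e) := by
    intro e
    rw [hL]
    ext i
    simp [ι]
  have himg : ι '' ((expand b W).support : Set (Fin 2 →₀ ℕ)) = L '' (ι '' (W.support : Set (Fin 2 →₀ ℕ))) := by
    rw [support_expand W hb, Finset.coe_image, Set.image_image, Set.image_image]
    exact Set.image_congr fun e _ => hι e
  show (Set.extremePoints ℝ (convexHull ℝ (ι '' ((expand b W).support : Set (Fin 2 →₀ ℕ))))).ncard =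
    (Set.extremePoints ℝ (convexHull ℝ (ι '' (W.support : Set (Fin 2 →₀ ℕ))))).ncard
  rw [himg, ← LinearEquiv.coe_toLinearMap, ← LinearMap.image_convexHull, LinearEquiv.coe_toLinearMap,
    ← image_extremePoints, Set.ncard_image_of_injective _ L.injective]

/-- MAHLER'S FUNCTIONAL EQUATION for the recursion (the card's `RadixSplitting`, coarse part): peeling the finest
scale of a radix frame leaves `expand b` of the radix frame of the shifted digits. [folklore] -/
theorem coarseDiff_radix_zero (b : ℕ) {m : ℕ} (D E : Fin (m + 1) → Poly) :
    coarseDiff (radix b D) (radix b E) 0 =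
      expand b (∏ j, radix b (fun j => D j.succ) j - ∏ j, radix b (fun j => E j.succ) j) := by
  simp only [coarseDiff, radix, Fin.zero_succAbove, Fin.val_succ, pow_succ', expand_mul, map_sub, map_prod]

/-- Hence the coarse vertex count of a radix frame is the vertex count of the shifted instance. [folklore] -/
theorem vert_coarseDiff_radix {b : ℕ} (hb : b ≠ 0) {m : ℕ} (D E : Fin (m + 1) → Poly) :
    vert (coarseDiff (radix b D) (radix b E) 0) =
      vert (∏ j, radix b (fun j => D j.succ) j - ∏ j, radix b (fun j => E j.succ) j) := by
  rw [coarseDiff_radix_zero, vert_expand hb]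

/-! ### From (β_r) to `RadixTwoProducts`: `V(m+1) ≤ V(m) + (m+3)t + (t+r+2)^κ` -/

/-- The additive recursion bound of the regime. [folklore] -/
def H (t r κ : ℕ) : ℕ → ℕ
  | 0 => 0
  | k + 1 => H t r κ k + (k + 3) * t + (t + r + 2) ^ κ

/-- INDUCTION ON SCALES in the radix regime (Mahler recursion: the coarse pair is the scaled shifted instance).
[folklore] -/
theorem vert_radix_le_H {κ : ℕ}
    (hβ : ∀ (b r m t : ℕ) (D E : Fin (m + 1) → Poly), 2 ≤ b → (∀ j, (D j).support.card ≤ t) →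
      (∀ j, (E j).support.card ≤ t) → (∀ j, ∀ e ∈ (D j).support, ∀ l, e l < r * b) →
      (∀ j, ∀ e ∈ (E j).support, ∀ l, e l < r * b) →
        vert (∏ j, radix b D j - ∏ j, radix b E j) ≤
          vert (coarseDiff (radix b D) (radix b E) 0) + (m + 3) * t + (t + r + 2) ^ κ) :
    ∀ (m b r t : ℕ) (D E : Fin m → Poly), 2 ≤ b → (∀ j, (D j).support.card ≤ t) →
      (∀ j, (E j).support.card ≤ t) → (∀ j, ∀ e ∈ (D j).support, ∀ l, e l < r * b) →
      (∀ j, ∀ e ∈ (E j).support, ∀ l, e l < r * b) →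
        vert (∏ j, radix b D j - ∏ j, radix b E j) ≤ H t r κ m := by
  intro m
  induction m with
  | zero =>
    intro b r t D E _ _ _ _ _
    have h0 : (∏ j, radix b D j - ∏ j, radix b E j : Poly) = 0 := by simp
    rw [h0, vert_zero]
    exact Nat.zero_le _
  | succ m ih =>
    intro b r t D E hb hD hE hDd hEd
    have hb0 : b ≠ 0 := by omega
    have hstep := hβ b r m t D E hb hD hE hDd hEd
    have hW : vert (coarseDiff (radix b D) (radix b E) 0) ≤ H t r κ m := by
      rw [vert_coarseDiff_radix hb0]
      exact ih b r t (fun j => D j.succ) (fun j => E j.succ) hb (fun j => hD _) (fun j => hE _)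
        (fun j => hDd _) (fun j => hEd _)
    calc vert (∏ j, radix b D j - ∏ j, radix b E j)
        ≤ vert (coarseDiff (radix b D) (radix b E) 0) + (m + 3) * t + (t + r + 2) ^ κ := hstep
      _ ≤ H t r κ m + (m + 3) * t + (t + r + 2) ^ κ := by gcongr
      _ = H t r κ (m + 1) := rfl

/-- Unrolling: `H(k) ≤ k·((k+2)t + (t+r+2)^κ)`. [folklore] -/
theorem H_le (t r κ : ℕ) : ∀ k, H t r κ k ≤ k * ((k + 2) * t + (t + r + 2) ^ κ)
  | 0 => by simp [H]
  | k + 1 => by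
    have ih := H_le t r κ k
    calc H t r κ (k + 1) = H t r κ k + (k + 3) * t + (t + r + 2) ^ κ := rfl
      _ ≤ k * ((k + 2) * t + (t + r + 2) ^ κ) + (k + 3) * t + (t + r + 2) ^ κ := by omega
      _ ≤ (k + 1) * ((k + 3) * t + (t + r + 2) ^ κ) := by
          nlinarith [Nat.zero_le (k * t), Nat.zero_le ((t + r + 2) ^ κ)]

/-- Absorbing two polynomial terms into one power. [folklore] -/
theorem absorb (Y κ A B : ℕ) (hY : 2 ≤ Y) (hA : A ≤ Y ^ 3) (hB : B ≤ Y ^ (κ + 1)) : A + B ≤ Y ^ (κ + 4) := by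
  have h3 : Y ^ 3 ≤ Y ^ (κ + 3) := Nat.pow_le_pow_right (by omega) (by omega)
  have h4 : Y ^ (κ + 1) ≤ Y ^ (κ + 3) := Nat.pow_le_pow_right (by omega) (by omega)
  have h5 : 2 * Y ^ (κ + 3) ≤ Y ^ (κ + 4) :=
    calc 2 * Y ^ (κ + 3) ≤ Y * Y ^ (κ + 3) := Nat.mul_le_mul_right _ hY
      _ = Y ^ (κ + 4) := by ring
  omega

/-- Closed form: `H(m) ≤ (m+t+r+2)^(κ+4)`. [folklore] -/
theorem H_bound (t r κ m : ℕ) : H t r κ m ≤ (m + t + r + 2) ^ (κ + 4) := by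
  have h1 : m * ((m + 2) * t) ≤ (m + t + r + 2) ^ 3 :=
    calc m * ((m + 2) * t) ≤ (m + t + r + 2) * ((m + t + r + 2) * (m + t + r + 2)) := by
          gcongr <;> omega
      _ = (m + t + r + 2) ^ 3 := by ring
  have h2 : m * (t + r + 2) ^ κ ≤ (m + t + r + 2) ^ (κ + 1) :=
    calc m * (t + r + 2) ^ κ ≤ (m + t + r + 2) * (m + t + r + 2) ^ κ :=
          Nat.mul_le_mul (by omega) (Nat.pow_le_pow_left (by omega) κ)
      _ = (m + t + r + 2) ^ (κ + 1) := by ring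
  calc H t r κ m ≤ m * ((m + 2) * t + (t + r + 2) ^ κ) := H_le t r κ m
    _ = m * ((m + 2) * t) + m * (t + r + 2) ^ κ := by ring
    _ ≤ (m + t + r + 2) ^ (κ + 4) := absorb _ κ _ _ (by omega) h1 h2

/-- **The regime theorem from the stub**: (β_r) `stub_radixScaleStep` implies `RadixTwoProducts` with exponent
`κ + 4`.  Sorry-free apart from the stub it invokes. [folklore] -/
theorem radixTwoProducts_of : RadixTwoProducts := by
  obtain ⟨κ, hβ⟩ := stub_radixScaleStep
  refine ⟨κ + 4, fun b r m t D E hb hD hE hDd hEd => ?_⟩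
  exact (vert_radix_le_H hβ m b r t D E hb hD hE hDd hEd).trans (H_bound t r κ m)

end

end Summit.ValiantsHypothesis.ValiantsHypothesis.Cruxes.TwoProducts.MahlerRadixRecursion
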